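import Summits.HubbardSuperconductivity.HubbardSuperconductivity.Theorems.AposterioriCapRgSsbToEvenTorusLroDoubleCommBound
import Summits.HubbardSuperconductivity.HubbardSuperconductivity.Theorems.WeakCouplingBCSWcbcsSsbToTorusLROMomentClosure
import Summits.HubbardSuperconductivity.HubbardSuperconductivity.Theorems.WeakCouplingBCSWcbcsSsbToTorusLROPairCommutatorBudget
import Summits.HubbardSuperconductivity.HubbardSuperconductivity.Theorems.WeakCouplingBCSWcbcsSsbToTorusLROWindowLatticeSums
import Summits.HubbardSuperconductivity.HubbardSuperconductivity.Theorems.WeakCouplingBCSWcbcsSsbToTorusLROTwoParticleCost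
import HarnessLib

/-!
# Crux `WcbcsSsbToTorusLRO` (stmt-HubbardSuperconductivity-2009), line `off-zero-mode-moment-closure`:
# the INFRARED HALF, closed modulo torus pair stiffness (T) and the charging floor (C)

`infraredLeak_of_stiffness_of_charging`: at fixed `(U, δ)`, `U > 0`, `δ ∈ (0, 1/2)`, the two OPEN physical inputs
of the line — (T) torus pair STIFFNESS in the variational own-bottom form (for every admissible ground state `ψ`,
every window momentum `m ≠ 0` and every `w` in the neighbouring sector `(N_L ∓ 2, S^z = 0)`,
`2 Re⟨w, Δ_d(m)^{(†)}ψ⟩ − Re⟨w, (H − E(N_L∓2)) w⟩ ≤ C L²/|q_m|²`) and (C) the CHARGING FLOOR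
(`(1 + log L) · pairGap(H, N_L) ≥ −ε` eventually, every `ε > 0`) — imply the pointwise INFRARED LEAK at `(U, δ)`:
for every budget `b > 0` there is a window `η > 0` such that eventually along even sides every normalised
`(N_L, S^z=0)`-sector ground state has `L⁻² Σ_{0<|q_m|<η} S_ψ(m) ≤ b` — literally the hypothesis `hIR` of the landed
`Negative.FacePurityDissection.floor_of_deriv_of_leak` and the pointwise form of item stmt-HubbardSuperconductivity-1089
`KacWindowPenalty.WindowInfraredBound` (whose docstring names exactly this tenure split: (3a) Pitaevskii–Stringari,
(3b) `χ_L(q) ≤ C′L²/|q|²`). Everything else is LANDED and consumed here by name: the per-side moment closure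
`stub_momentClosure` (kernel `S² ≤ F̂·X`, own-bottom identity, quadratic self-consistency; p86989), the momentum-`q`
double-commutator budget `Theorems.stub_doubleCommBound` (F1), the pair-commutator budget `stub_pairCommutatorBudget`
(F2; p87816), the two-particle cost `stub_twoParticleCost` (F3; p89916) and the 2-d lattice sums
`stub_windowLatticeSums` (p89356). Constants: per-momentum ceiling `S_ψ(m) ≤ √((C₁+B₃C₂)C_T)/|q_m| + 2 g C_T/|q_m|²`
with `g = ε_C/(1 + log L)`; window `η = min(η₀, b/(4(K₁c+1)))`, `ε_C = b/(8(C_T c + 1))`, side so large that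
`K₁ c / L ≤ b/4`. References: Pitaevskii–Stringari, J. Low Temp. Phys. 85 (1991) 377; Kennedy–Lieb–Shastry,
PRL 61 (1988) 2582; Koma–Tasaki, J. Stat. Phys. 76 (1994) 745, Thm 2.2.
-/

noncomputable section

set_option linter.dupNamespace false

namespace Summit.HubbardSuperconductivity.HubbardSuperconductivity.Theorems.WcbcsSsbToTorusLRO

open Literature.MathematicalPhysics.QuantumLattice Literature.Probability.LatticeModels
open Matrix Filter Set
open scoped ComplexOrder ComplexConjugate

/-- `N_L ≥ 2` on every side `L ≥ 2` when `δ < 1/2`. -/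
theorem two_le_summitNumber {δ : ℝ} (hδ : δ < 1 / 2) (L : ℕ) (hL : 2 ≤ L) :
    2 ≤ 2 * ⌊(1 - δ) * (L : ℝ) ^ 2 / 2⌋₊ := by
  have hL' : (2 : ℝ) ≤ (L : ℝ) := by exact_mod_cast hL
  have h1 : (1 : ℝ) ≤ (1 - δ) * (L : ℝ) ^ 2 / 2 := by nlinarith
  have h2 : 1 ≤ ⌊(1 - δ) * (L : ℝ) ^ 2 / 2⌋₊ := Nat.le_floor (by exact_mod_cast h1)
  omega

/-- Real bookkeeping of the per-momentum ceiling: from `S ≤ √((B₁ + B₃B₂)X) + 2gX` with `B₁ = C₁A`, `B₂ = C₂A`,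
`X = C_T A / q` (`A = L²`, `q = |q_m|² > 0`) to `S/A ≤ √((C₁ + B₃C₂)C_T)/√q + 2 g C_T/q`. -/
theorem perMomentum_arith {S A q C₁ C₂ B₃ CT g : ℝ} (hA : 0 < A) (hq : 0 < q) (hC₁ : 0 ≤ C₁) (hC₂ : 0 ≤ C₂)
    (hB₃ : 0 ≤ B₃) (hCT : 0 ≤ CT) (_hg : 0 ≤ g)
    (hS : S ≤ Real.sqrt ((C₁ * A + B₃ * (C₂ * A)) * (CT * A / q)) + 2 * g * (CT * A / q)) :
    S / A ≤ Real.sqrt ((C₁ + B₃ * C₂) * CT) * (1 / Real.sqrt q) + 2 * g * CT * (1 / q) := by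
  have e1 : (C₁ * A + B₃ * (C₂ * A)) * (CT * A / q) = ((C₁ + B₃ * C₂) * CT) * (A ^ 2 / q) := by
    field_simp
  have e2 : Real.sqrt (((C₁ + B₃ * C₂) * CT) * (A ^ 2 / q)) =
      Real.sqrt ((C₁ + B₃ * C₂) * CT) * (A / Real.sqrt q) := by
    rw [Real.sqrt_mul (by positivity), Real.sqrt_div (by positivity), Real.sqrt_sq hA.le]
  rw [e1, e2] at hS
  rw [div_le_iff₀ hA]
  have e3 : (Real.sqrt ((C₁ + B₃ * C₂) * CT) * (1 / Real.sqrt q) + 2 * g * CT * (1 / q)) * A =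
      Real.sqrt ((C₁ + B₃ * C₂) * CT) * (A / Real.sqrt q) + 2 * g * (CT * A / q) := by
    field_simp
  rw [e3]
  exact hS

/-- **The infrared leak at `(U, δ)` from torus pair stiffness (T) and the charging floor (C)** — shape `hIR` of
the landed `floor_of_deriv_of_leak`; the finite-`L` inputs F1/F2/F3, the lattice sums and the moment closure are
the landed theorems named in the module docstring. -/
theorem infraredLeak_of_stiffness_of_charging :
    ∀ (U δ : ℝ), 0 < U → δ ∈ Set.Ioo (0:ℝ) (1 / 2) → (∃ C η : ℝ, 0 < η ∧ ∀ᶠ k : ℕ in Filter.atTop, ∀ ψ : Fock (Orb (FermionTorus 2 (2 * k + 1 + 1))), IsGroundStateInSector (hubbardTorus 2 (2 * k + 1 + 1) 1 U) (2 * ⌊(1 - δ) * ((2 * k + 1 + 1 : ℕ) : ℝ) ^ 2 / 2⌋₊) 0 ψ → star ψ ⬝ᵥ ψ = 1 → ∀ m : TorusSite 2 (2 * k + 1 + 1), m ≠ 0 → momentumNormSq (2 * k + 1 + 1) m < η ^ 2 → (∀ w : Fock (Orb (FermionTorus 2 (2 * k + 1 + 1))), w ∈ szSector (Λ := FermionTorus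 2 (2 * k + 1 + 1)) (2 * ⌊(1 - δ) * ((2 * k + 1 + 1 : ℕ) : ℝ) ^ 2 / 2⌋₊ - 2) 0 → 2 * (star w ⬝ᵥ (pairFieldAt dWaveFormFactor (2 * k + 1 + 1) m *ᵥ ψ)).re - ((star w ⬝ᵥ (hubbardTorus 2 (2 * k + 1 + 1) 1 U *ᵥ w)).re - (hubbardTorus 2 (2 * k + 1 + 1) 1 U).minEnergyOn (szSector (2 * ⌊(1 - δ) * ((2 * k + 1 + 1 : ℕ) : ℝ) ^ 2 / 2⌋₊ - 2) 0) * (star w ⬝ᵥ w).re) ≤ C * ((2 * k + 1 + 1 : ℕ) : ℝ) ^ 2 / momentumNormSq (2 * k + 1 + 1) m) ∧ (∀ w : Fock (Orb (FermionTorus 2 (2 * k + 1 + 1))), w ∈ szSector (Λ := FermionTorus 2 (2 * k + 1 + 1)) (2 * ⌊(1 - δ) * ((2 * k + 1 + 1 : ℕ) : ℝ) ^ 2 / 2⌋₊ + 2) 0 → 2 * (star w ⬝ᵥ ((pairFieldAt dWaveFormFactor (2 * k + 1 + 1) m)ᴴ *ᵥ ψ)).re - ((star w ⬝ᵥ (hubbardTorus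 2 (2 * k + 1 + 1) 1 U *ᵥ w)).re - (hubbardTorus 2 (2 * k + 1 + 1) 1 U).minEnergyOn (szSector (2 * ⌊(1 - δ) * ((2 * k + 1 + 1 : ℕ) : ℝ) ^ 2 / 2⌋₊ + 2) 0) * (star w ⬝ᵥ w).re) ≤ C * ((2 * k + 1 + 1 : ℕ) : ℝ) ^ 2 / momentumNormSq (2 * k + 1 + 1) m)) → (∀ ε : ℝ, 0 < ε → ∀ᶠ k : ℕ in Filter.atTop, -ε ≤ (1 + Real.log ((2 * k + 1 + 1 : ℕ) : ℝ)) * pairGap (hubbardTorus 2 (2 * k + 1 + 1) 1 U) (2 * ⌊(1 - δ) * ((2 * k + 1 + 1 : ℕ) : ℝ) ^ 2 / 2⌋₊)) → ∀ b : ℝ, 0 < b → ∃ η : ℝ, 0 < η ∧ ∀ᶠ k : ℕ in Filter.atTop, ∀ ψ : Fock (Orb (FermionTorus 2 (2 * k + 1 + 1))), IsGroundStateInSector (hubbardTorus 2 (2 * k + 1 + 1) 1 U) (2 * ⌊(1 - δ) * (((2 * k + 1 + 1) : ℕ) : ℝ) ^ 2 / 2⌋₊) 0 ψ → star ψ ⬝ᵥ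 ψ = 1 → (∑ m ∈ (Finset.univ.filter fun m : Literature.Probability.LatticeModels.TorusSite 2 (2 * k + 1 + 1) => m ≠ 0 ∧ momentumNormSq (2 * k + 1 + 1) m < η ^ 2), pairStructureFactor dWaveFormFactor (2 * k + 1 + 1) ψ m) / ((2 * k + 1 + 1 : ℕ) : ℝ) ^ 2 ≤ b := by
  intro U δ hU hδ hT hC
  obtain ⟨C₂, hC₂, hF2⟩ := stub_pairCommutatorBudget
  obtain ⟨c, hc, hLat1, hLat2⟩ := stub_windowLatticeSums
  obtain ⟨CT₀, η₀, hη₀, hTev⟩ := hT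
  obtain ⟨C₁, hC₁, hF1⟩ := stub_doubleCommBound U hU
  obtain ⟨B₃, hB₃, hF3ev⟩ := stub_twoParticleCost U δ hδ
  intro b hb
  -- constants
  set CT : ℝ := max CT₀ 0 with hCT_def
  have hCT : 0 ≤ CT := le_max_right _ _
  have hCT₀ : CT₀ ≤ CT := le_max_left _ _
  set K₁ : ℝ := Real.sqrt ((C₁ + B₃ * C₂) * CT) with hK₁_def
  have hK₁ : 0 ≤ K₁ := Real.sqrt_nonneg _
  set η : ℝ := min η₀ (b / (4 * (K₁ * c + 1))) with hη_def
  have hKc : 0 < K₁ * c + 1 := by positivity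
  have hη : 0 < η := lt_min hη₀ (by positivity)
  have hηη₀ : η ≤ η₀ := min_le_left _ _
  have hηb : K₁ * c * η ≤ b / 4 := by
    have h1 : η ≤ b / (4 * (K₁ * c + 1)) := min_le_right _ _
    have h2 : K₁ * c * η ≤ K₁ * c * (b / (4 * (K₁ * c + 1))) := mul_le_mul_of_nonneg_left h1 (by positivity)
    refine h2.trans ?_
    rw [mul_div_assoc', div_le_div_iff₀ (by positivity) (by norm_num : (0:ℝ) < 4)]
    nlinarith
  set εC : ℝ := b / (8 * (CT * c + 1)) with hεC_def
  have hCc : 0 < CT * c + 1 := by positivity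
  have hεC : 0 < εC := by positivity
  have hεCb : 2 * CT * c * εC ≤ b / 4 := by
    rw [hεC_def, mul_div_assoc', div_le_div_iff₀ (by positivity) (by norm_num : (0:ℝ) < 4)]
    nlinarith [mul_nonneg hCT hc]
  -- the large-side threshold for the `1/L` term
  obtain ⟨L₂, hL₂⟩ := exists_nat_gt (4 * (K₁ * c + 1) / b)
  refine ⟨η, hη, ?_⟩
  have hCev := hC εC hεC
  filter_upwards [hTev, hCev, hF3ev, eventually_ge_atTop L₂] with k hTk hCk hF3k hkL
  intro ψ hψ hψ1
  -- abbreviations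
  have hLpos : (0 : ℝ) < ((2 * k + 1 + 1 : ℕ) : ℝ) := by positivity
  have hA : (0 : ℝ) < ((2 * k + 1 + 1 : ℕ) : ℝ) ^ 2 := by positivity
  have hN2 : 2 ≤ 2 * ⌊(1 - δ) * ((2 * k + 1 + 1 : ℕ) : ℝ) ^ 2 / 2⌋₊ :=
    two_le_summitNumber hδ.2 (2 * k + 1 + 1) (by omega)
  -- the charging datum `g`
  set lg : ℝ := 1 + Real.log ((2 * k + 1 + 1 : ℕ) : ℝ) with hlg_def
  have hlg : 1 ≤ lg := by
    have : 0 ≤ Real.log ((2 * k + 1 + 1 : ℕ) : ℝ) := Real.log_nonneg (by exact_mod_cast (by omega : 1 ≤ 2 * k + 1 + 1))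
    linarith
  have hlgpos : 0 < lg := by linarith
  set g : ℝ := εC / lg with hg_def
  have hg : 0 ≤ g := by positivity
  have hgC : -g ≤ pairGap (hubbardTorus 2 (2 * k + 1 + 1) 1 U) (2 * ⌊(1 - δ) * ((2 * k + 1 + 1 : ℕ) : ℝ) ^ 2 / 2⌋₊) := by
    rw [hg_def, neg_le, le_div_iff₀ hlgpos]
    linarith [hCk]
  -- F1 at μ = 0 and F2 on the unit vector ψ
  have hF1ψ : ∀ m : TorusSite 2 (2 * k + 1 + 1),
      (star ψ ⬝ᵥ (((pairFieldAt dWaveFormFactor (2 * k + 1 + 1) m)ᴴ * (hubbardTorus 2 (2 * k + 1 + 1) 1 U * pairFieldAt dWaveFormFactor (2 * k + 1 + 1) m - pairFieldAt dWaveFormFactor (2 * k + 1 + 1) m * hubbardTorus 2 (2 * k + 1 + 1) 1 U) - (hubbardTorus 2 (2 * k + 1 + 1) 1 U * pairFieldAt dWaveFormFactor (2 * k + 1 + 1) m - pairFieldAt dWaveFormFactor (2 * k + 1 + 1) m * hubbardTorus 2 (2 * k + 1 + 1) 1 U) * (pairFieldAt dWaveFormFactor (2 * k + 1 + 1) m)ᴴ)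 *ᵥ ψ)).re ≤ C₁ * ((2 * k + 1 + 1 : ℕ) : ℝ) ^ 2 := by
    intro m
    have h := hF1 (2 * k + 1 + 1) 0 m ψ
    rw [hubbardTorusWith_zero, abs_zero, add_zero, mul_one, hψ1, Complex.one_re, mul_one] at h
    exact (le_abs_self _).trans h
  have hF2ψ : ∀ m : TorusSite 2 (2 * k + 1 + 1),
      |(star ψ ⬝ᵥ (((pairFieldAt dWaveFormFactor (2 * k + 1 + 1) m)ᴴ * pairFieldAt dWaveFormFactor (2 * k + 1 + 1) m - pairFieldAt dWaveFormFactor (2 * k + 1 + 1) m * (pairFieldAt dWaveFormFactor (2 * k + 1 + 1) m)ᴴ) *ᵥ ψ)).re| ≤ C₂ * ((2 * k + 1 + 1 : ℕ) : ℝ) ^ 2 := by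
    intro m
    have h := hF2 (2 * k + 1 + 1) m ψ
    rwa [hψ1, Complex.one_re, mul_one] at h
  -- the per-momentum ceiling on the window
  have hterm : ∀ m ∈ (Finset.univ.filter fun m : TorusSite 2 (2 * k + 1 + 1) =>
      m ≠ 0 ∧ momentumNormSq (2 * k + 1 + 1) m < η ^ 2),
      pairStructureFactor dWaveFormFactor (2 * k + 1 + 1) ψ m ≤
        K₁ * (1 / Real.sqrt (momentumNormSq (2 * k + 1 + 1) m)) + 2 * g * CT * (1 / momentumNormSq (2 * k + 1 + 1) m) := by
    intro m hm
    rw [Finset.mem_filter] at hm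
    obtain ⟨-, hm0, hmη⟩ := hm
    have hmη₀ : momentumNormSq (2 * k + 1 + 1) m < η₀ ^ 2 :=
      lt_of_lt_of_le hmη (pow_le_pow_left₀ hη.le hηη₀ 2)
    have hq : 0 < momentumNormSq (2 * k + 1 + 1) m :=
      lt_of_le_of_ne (momentumNormSq_nonneg m) (fun h => hm0 ((momentumNormSq_eq_zero_iff m).1 h.symm))
    obtain ⟨hTm, hTp⟩ := hTk ψ hψ hψ1 m hm0 hmη₀
    -- the stub bound `CT₀ L²/q` is below `X = CT L²/q`
    set X : ℝ := CT * ((2 * k + 1 + 1 : ℕ) : ℝ) ^ 2 / momentumNormSq (2 * k + 1 + 1) m with hX_def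
    have hX : 0 ≤ X := by positivity
    have hXle : CT₀ * ((2 * k + 1 + 1 : ℕ) : ℝ) ^ 2 / momentumNormSq (2 * k + 1 + 1) m ≤ X :=
      div_le_div_of_nonneg_right (mul_le_mul_of_nonneg_right hCT₀ hA.le) hq.le
    have hMC := stub_momentClosure (2 * k + 1 + 1) U _ hN2 ψ hψ hψ1 m X
      (C₁ * ((2 * k + 1 + 1 : ℕ) : ℝ) ^ 2) (C₂ * ((2 * k + 1 + 1 : ℕ) : ℝ) ^ 2) B₃ g hX (by positivity) (by positivity) hB₃ hg
      (fun w hw => (hTm w hw).trans hXle) (fun w hw => (hTp w hw).trans hXle) (hF1ψ m) (hF2ψ m) hF3k.1 hgC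
    rw [pairStructureFactor_apply]
    exact perMomentum_arith hA hq hC₁ hC₂ hB₃ hCT hg hMC
  -- summation over the window
  have hsum := Finset.sum_le_sum hterm
  rw [Finset.sum_add_distrib, ← Finset.mul_sum, ← Finset.mul_sum] at hsum
  have hlat1 := hLat1 (2 * k + 1 + 1) η hη
  have hlat2' : (∑ m ∈ (Finset.univ.filter fun m : TorusSite 2 (2 * k + 1 + 1) =>
      m ≠ 0 ∧ momentumNormSq (2 * k + 1 + 1) m < η ^ 2), 1 / momentumNormSq (2 * k + 1 + 1) m) ≤
      c * ((2 * k + 1 + 1 : ℕ) : ℝ) ^ 2 * lg := by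
    refine le_trans ?_ (hLat2 (2 * k + 1 + 1))
    refine Finset.sum_le_sum_of_subset_of_nonneg (fun m hm => ?_) (fun m _ _ => ?_)
    · rw [Finset.mem_filter] at hm ⊢
      exact ⟨hm.1, hm.2.1⟩
    · exact div_nonneg zero_le_one (momentumNormSq_nonneg m)
  have h1L : K₁ * c / ((2 * k + 1 + 1 : ℕ) : ℝ) ≤ b / 4 := by
    have hkL' : (L₂ : ℝ) ≤ ((2 * k + 1 + 1 : ℕ) : ℝ) := by exact_mod_cast (by omega : L₂ ≤ 2 * k + 1 + 1)
    have h1 : 4 * (K₁ * c + 1) / b < ((2 * k + 1 + 1 : ℕ) : ℝ) := hL₂.trans_le hkL'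
    rw [div_lt_iff₀ hb] at h1
    rw [div_le_iff₀ hLpos]
    nlinarith [mul_nonneg hK₁ hc]
  rw [div_le_iff₀ hA]
  calc (∑ m ∈ (Finset.univ.filter fun m : TorusSite 2 (2 * k + 1 + 1) =>
            m ≠ 0 ∧ momentumNormSq (2 * k + 1 + 1) m < η ^ 2),
          pairStructureFactor dWaveFormFactor (2 * k + 1 + 1) ψ m)
      ≤ K₁ * (∑ m ∈ (Finset.univ.filter fun m : TorusSite 2 (2 * k + 1 + 1) =>
            m ≠ 0 ∧ momentumNormSq (2 * k + 1 + 1) m < η ^ 2), 1 / Real.sqrt (momentumNormSq (2 * k + 1 + 1) m)) +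
        2 * g * CT * (∑ m ∈ (Finset.univ.filter fun m : TorusSite 2 (2 * k + 1 + 1) =>
            m ≠ 0 ∧ momentumNormSq (2 * k + 1 + 1) m < η ^ 2), 1 / momentumNormSq (2 * k + 1 + 1) m) := hsum
    _ ≤ K₁ * (c * (η * ((2 * k + 1 + 1 : ℕ) : ℝ) ^ 2 + ((2 * k + 1 + 1 : ℕ) : ℝ))) +
        2 * g * CT * (c * ((2 * k + 1 + 1 : ℕ) : ℝ) ^ 2 * lg) := by
        gcongr
    _ = (K₁ * c * η + K₁ * c / ((2 * k + 1 + 1 : ℕ) : ℝ) + 2 * CT * c * εC) * ((2 * k + 1 + 1 : ℕ) : ℝ) ^ 2 := by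
        rw [hg_def]
        field_simp
    _ ≤ b * ((2 * k + 1 + 1 : ℕ) : ℝ) ^ 2 := by
        refine mul_le_mul_of_nonneg_right ?_ hA.le
        linarith

end Summit.HubbardSuperconductivity.HubbardSuperconductivity.Theorems.WcbcsSsbToTorusLRO

end
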